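import Literature.MathematicalPhysics.QuantumLattice.MatrixProductStatesAkltProofs
import Literature.MathematicalPhysics.QuantumLattice.MatrixProductStatesPeriodicGroundStateProofs
import Literature.MathematicalPhysics.QuantumLattice.SpinOperatorsProofs
import Literature.MathematicalPhysics.QuantumLattice.LocalOpTransport
import HarnessLib

/-!
# Discharged fact: the AKLT Hamiltonian is the parent Hamiltonian of the AKLT tensor

Trunk **T-QLATTICE**. Sibling proof file of
`Literature/MathematicalPhysics/QuantumLattice/MatrixProductStates.lean` (next to
`MatrixProductStatesProofs.lean`, `MatrixProductStatesAkltProofs.lean`,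
`MatrixProductStatesGroundStateProofs.lean`, `MatrixProductStatesPeriodicGroundStateProofs.lean`).
It discharges the named fact (`def X : Prop`, D-0014)

* `Literature.MathematicalPhysics.QuantumLattice.parentHamiltonian_akltTensor_eq` —
  on the ring `ℤ/L`, `2 ≤ L`, the parent Hamiltonian of the AKLT tensor with block length `2` is
  `Σ_i (⅙ (𝐒_i · 𝐒_{i+1})² + ½ 𝐒_i · 𝐒_{i+1} + ⅓) = Σ_i P₂(i, i+1)`
  (`parentHamiltonian_akltTensor_eq_holds`);

no statement or definition is introduced or changed (the file is theorem-only).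

## Source

M. Fannes, B. Nachtergaele, R. F. Werner, *Finitely correlated states on quantum spin chains*,
Comm. Math. Phys. **144** (1992) 443–490: eq. (1.1), p. 445 — the AKLT Hamiltonian is
`Σ_i {½ 𝐒_i · 𝐒_{i+1} + ⅙ (𝐒_i · 𝐒_{i+1})² + ⅓}` and "the expression in braces is nothing but the
projection onto the spin 2 subspace"; §7, pp. 485–486 — for their `SU(2)`-invariant examples
with bond spin `j` and site spin `J` the two-site range `V⁽²⁾𝒦 = 𝒢₂` lies in the subspace of
total spin `≤ 2j`, the projection onto the spins `> 2j` exposes the state, and "the simplest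
example of this situation occurs when `J = 1` and `j = 1/2`. In this case the nearest neighbor
interaction `h` is precisely the AKLT model" (`h` = the projection onto `𝒢₂ᗮ`, Def. 5.4,
eq. (5.11)). I. Affleck, T. Kennedy, E. H. Lieb, H. Tasaki, CMP **115** (1988), eq. (1.2), §2.

## Proof

Write `D = 𝐒₀ · 𝐒₁ ∈ Op (Fin 2) 3` (`spinDot 2 0 1`) and `P₂ = ⅙ D² + ½ D + ⅓`.
(1) Two-site spin-`1` algebra: `⟨σ|D|τ⟩ = Σ_α S^α_{σ₀τ₀} S^α_{σ₁τ₁}` (`spinDot_fin_two_apply`),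
`Σ_α S^α ⊗ S^α = Sᶻ⊗Sᶻ + ½(S⁺⊗S⁻ + S⁻⊗S⁺)` (`sum_spinVec_mul_spinVec`) and the spin-`1` entries of
`S^±, Sᶻ` give the action of `D` on two-site vectors as a `3 × 3` table of linear forms
(`spinDot_two_mulVec_apply`). (2) With `A⁺ = s σ⁺`, `A⁰ = -t σᶻ`, `A⁻ = -s σ⁻`, `s² = 2/3`,
`t² = 1/3` (`akltTensor_eq_of_sq`) the amplitudes `ψ_B(k₀,k₁) = tr(B A^{k₀} A^{k₁})` are an
explicit table (`mpsWithBoundary_two_aklt_apply`). (3) The two inclusions `𝒢₂ ⊆ ker P₂`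
(`akltProj_mulVec_mpsWithBoundary`: `P₂ ψ_B = 0`, uses `s² = 2t²`) and `ran (1 - P₂) ⊆ 𝒢₂`
(`mpsWithBoundary_two_aklt_eq_sub_akltProj_mulVec`: `u - P₂ u = ψ_{B(u)}` for an explicit `B(u)`)
are `9`-case entrywise computations, polynomial identities in `s, t` modulo `s² = 2/3`,
`t² = 1/3`. (4) A matrix `P` with `P v ∈ Kᗮ` and `v - P v ∈ K` for all `v` is `projMatrix Kᗮ`
(`projMatrix_orthogonal_eq_of`, from Mathlib's `Submodule.eq_starProjection_of_mem_orthogonal`);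
as `P₂` is Hermitian, `parentLocalTerm 2 akltTensor = P₂` (`parentLocalTerm_two_akltTensor`).
(5) Placing a two-site operator on the block `{x, x+1}` of `ℤ/L` (`localOp ∘ onRingBlock`) is a
unital algebra homomorphism sending `onSite i a` to `onSite (x+i) a` (`LocalOpTransport`, along
`ringBlockSite_bijective`), hence `D ↦ 𝐒_x · 𝐒_{x+1}` (`localOp_onRingBlock_spinDot`) and
`P₂ ↦ P₂(x, x+1)`; summing over `x` gives the claim.

## References

* M. Fannes, B. Nachtergaele, R. F. Werner, Comm. Math. Phys. **144** (1992) 443–490,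
  doi:10.1007/bf02099178, eq. (1.1) p. 445, Def. 5.4, eq. (5.11), §7 pp. 484–486.
* I. Affleck, T. Kennedy, E. H. Lieb, H. Tasaki, Comm. Math. Phys. **115** (1988) 477–528.
* H. Tasaki, *Physics and Mathematics of Quantum Many-Body Systems* (Springer, 2020), §2.1,
  §2.4, §7.1; U. Schollwöck, Ann. Phys. **326** (2011) 96–192, §4.1.5 (AKLT tensor gauge).
-/

noncomputable section

open Matrix Complex

namespace Literature.MathematicalPhysics.QuantumLattice

section QLattice

/-! ### Two-site configurations -/

/-- A configuration on two sites is the pair of its values. [folklore] -/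
theorem eq_vecCons_fin_two {q : ℕ} (σ : Fin 2 → Fin q) : σ = ![σ 0, σ 1] := by
  ext i; fin_cases i <;> rfl

/-- Sums over two-site configurations are double sums over the two local states. [folklore] -/
theorem sum_tensorIndex_fin_two {M : Type*} [AddCommMonoid M] {q : ℕ} (f : (Fin 2 → Fin q) → M) :
    ∑ σ, f σ = ∑ a, ∑ b, f ![a, b] := by
  rw [← Fintype.sum_prod_type']
  exact Fintype.sum_equiv (finTwoArrowEquiv (Fin q)) _ _ fun σ => by
    simp only [finTwoArrowEquiv]
    exact congrArg f (eq_vecCons_fin_two σ)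

/-! ### Kronecker form of two-site products of single-site operators -/

/-- On two sites, `(a ⊗ 𝟙)(𝟙 ⊗ b) = a ⊗ b` entrywise. Tasaki (2020) §2.2. [folklore] -/
theorem onSite_zero_mul_onSite_one_apply {q : ℕ} (a b : Matrix (Fin q) (Fin q) ℂ)
    (σ τ : Fin 2 → Fin q) :
    (onSite (0 : Fin 2) a * onSite 1 b : Op (Fin 2) q) σ τ = a (σ 0) (τ 0) * b (σ 1) (τ 1) := by
  rw [Matrix.mul_apply, Finset.sum_eq_single (![τ 0, σ 1] : Fin 2 → Fin q)]
  · simp [onSite_apply, Fin.forall_fin_two]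
  · intro ρ _ hρ
    simp only [onSite_apply, Fin.forall_fin_two]
    split_ifs with h1 h2
    · exact absurd (by rw [eq_vecCons_fin_two ρ]; simp [← h1.2, h2.1]) hρ
    · exact mul_zero _
    · exact zero_mul _
    · exact zero_mul _
  · exact fun h => absurd (Finset.mem_univ _) h

/-- On two sites, `(𝟙 ⊗ b)(a ⊗ 𝟙) = a ⊗ b` entrywise. Tasaki (2020) §2.2. [folklore] -/
theorem onSite_one_mul_onSite_zero_apply {q : ℕ} (a b : Matrix (Fin q) (Fin q) ℂ)
    (σ τ : Fin 2 → Fin q) :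
    (onSite (1 : Fin 2) b * onSite 0 a : Op (Fin 2) q) σ τ = a (σ 0) (τ 0) * b (σ 1) (τ 1) := by
  rw [Matrix.mul_apply, Finset.sum_eq_single (![σ 0, τ 1] : Fin 2 → Fin q)]
  · simp [onSite_apply, Fin.forall_fin_two, mul_comm]
  · intro ρ _ hρ
    simp only [onSite_apply, Fin.forall_fin_two]
    split_ifs with h1 h2
    · exact absurd (by rw [eq_vecCons_fin_two ρ]; simp [← h1.1, h2.2]) hρ
    · exact mul_zero _
    · exact zero_mul _
    · exact zero_mul _
  · exact fun h => absurd (Finset.mem_univ _) h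

/-! ### The exchange operator of two spins `1` -/

/-- Entries of the two-site exchange operator: `⟨σ| 𝐒₀ · 𝐒₁ |τ⟩ = Σ_α S^α_{σ₀τ₀} S^α_{σ₁τ₁}`
(the symmetrisation in `spinDot` is immaterial). Tasaki (2020) §2.4, eq. (2.4.1). [folklore] -/
theorem spinDot_fin_two_apply (n : ℕ) (σ τ : Fin 2 → Fin (n + 1)) :
    spinDot n (0 : Fin 2) 1 σ τ =
      ∑ α : Fin 3, spinVec n α (σ 0) (τ 0) * spinVec n α (σ 1) (τ 1) := by
  simp only [spinDot, spinBond, siteSpin, Matrix.sum_apply, Matrix.smul_apply, Matrix.add_apply,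
    onSite_zero_mul_onSite_one_apply, onSite_one_mul_onSite_zero_apply, smul_eq_mul]
  exact Finset.sum_congr rfl fun α _ => by ring

/-- `Σ_α S^α ⊗ S^α = Sᶻ ⊗ Sᶻ + ½ (S⁺ ⊗ S⁻ + S⁻ ⊗ S⁺)`, entrywise.
Tasaki (2020) §2.1, eq. (2.1.6); §2.4. [folklore] -/
theorem sum_spinVec_mul_spinVec (n : ℕ) (a b c e : Fin (n + 1)) :
    ∑ α : Fin 3, spinVec n α a c * spinVec n α b e =
      SpinOperators.spinZ n a c * SpinOperators.spinZ n b e +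
        (1 / 2 : ℂ) * (spinRaise n a c * spinLower n b e + spinLower n a c * spinRaise n b e) := by
  simp only [Fin.sum_univ_three, spinVec_zero, spinVec_one, spinVec_two, spinX, spinY,
    Matrix.smul_apply, Matrix.add_apply, Matrix.sub_apply, smul_eq_mul]
  have hI : (1 / (2 * I) : ℂ) = -(I / 2) := by
    rw [div_eq_iff (mul_ne_zero two_ne_zero Complex.I_ne_zero)]
    linear_combination Complex.I_sq
  rw [hI]
  linear_combination
    ((spinRaise n a c - spinLower n a c) * (spinRaise n b e - spinLower n b e) / 4) * Complex.I_sq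

/-- Entries of `S⁺` for spin `1`: `√2` on the superdiagonal. Tasaki (2020) §2.1, eq. (2.1.6).
[folklore] -/
theorem spinRaise_two_apply (k l : Fin 3) :
    spinRaise 2 k l = if l.val = k.val + 1 then ((Real.sqrt 2 : ℝ) : ℂ) else 0 := by
  rw [spinRaise_apply]
  fin_cases k <;> fin_cases l <;> norm_num

/-- Entries of `S⁻` for spin `1`: `√2` on the subdiagonal. Tasaki (2020) §2.1, eq. (2.1.6).
[folklore] -/
theorem spinLower_two_apply (k l : Fin 3) :
    spinLower 2 k l = if k.val = l.val + 1 then ((Real.sqrt 2 : ℝ) : ℂ) else 0 := by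
  rw [spinLower_apply]
  fin_cases k <;> fin_cases l <;> norm_num

/-- Entries of `Sᶻ` for spin `1`: `diag(1, 0, -1)`. Tasaki (2020) §2.1, eq. (2.1.5). [folklore] -/
theorem spinZ_two_apply (k l : Fin 3) :
    SpinOperators.spinZ 2 k l = if k.val = l.val then 1 - (k : ℂ) else 0 := by
  rw [spinZ_apply]
  norm_num [Fin.ext_iff]

/-- **Action of the two-site spin-`1` exchange operator** `𝐒₀ · 𝐒₁` on a two-site vector `w`, in
the basis `|k₀ k₁⟩`, `k ↦ m = 1 - k`:
`(𝐒₀·𝐒₁ w)(k₀,k₁) = m₀ m₁ w(k₀,k₁) + w(k₀+1,k₁-1) + w(k₀-1,k₁+1)` (the last two terms when the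
indices exist), from `𝐒₀·𝐒₁ = Sᶻ⊗Sᶻ + ½(S⁺⊗S⁻ + S⁻⊗S⁺)` and
`⟨k|S⁺|k+1⟩ = √2`. Tasaki (2020) §2.4, Problem 2.4.a; AKLT (1988) §2. [folklore] -/
theorem spinDot_two_mulVec_apply (w : (Fin 2 → Fin 3) → ℂ) (a b : Fin 3) :
    (spinDot 2 (0 : Fin 2) 1 *ᵥ w) ![a, b] =
      ![![w ![0, 0], w ![1, 0], w ![1, 1] - w ![0, 2]],
        ![w ![0, 1], w ![0, 2] + w ![2, 0], w ![2, 1]],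
        ![w ![1, 1] - w ![2, 0], w ![1, 2], w ![2, 2]]] a b := by
  have hr : ((Real.sqrt 2 : ℝ) : ℂ) ^ 2 = 2 := by
    rw [← Complex.ofReal_pow, Real.sq_sqrt zero_le_two]; norm_num
  have hsum : (spinDot 2 (0 : Fin 2) 1 *ᵥ w) ![a, b] =
      ∑ c : Fin 3, ∑ e : Fin 3, spinDot 2 (0 : Fin 2) 1 ![a, b] ![c, e] * w ![c, e] := by
    simp only [Matrix.mulVec, dotProduct]
    exact sum_tensorIndex_fin_two (q := 3) _
  rw [hsum]
  simp only [spinDot_fin_two_apply, sum_spinVec_mul_spinVec]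
  simp only [Fin.sum_univ_three, spinRaise_two_apply, spinLower_two_apply, spinZ_two_apply,
    Matrix.cons_val_zero, Matrix.cons_val_one]
  fin_cases a <;> fin_cases b <;> norm_num <;> ring_nf <;> (try simp only [hr]) <;> (try ring_nf)

/-! ### The projection `P₂ = ⅙ (𝐒₀·𝐒₁)² + ½ 𝐒₀·𝐒₁ + ⅓` acting on vectors -/

/-- `(⅙ D² + ½ D + ⅓) v = ⅙ D(Dv) + ½ Dv + ⅓ v` entrywise, `D = 𝐒₀ · 𝐒₁`. [folklore] -/
theorem akltProj_mulVec_apply (v : (Fin 2 → Fin 3) → ℂ) (σ : Fin 2 → Fin 3) :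
    (((1 / 6 : ℂ) • (spinDot 2 (0 : Fin 2) 1 * spinDot 2 (0 : Fin 2) 1) +
        (1 / 2 : ℂ) • spinDot 2 (0 : Fin 2) 1 + (1 / 3 : ℂ) • (1 : Op (Fin 2) 3)) *ᵥ v) σ =
      (1 / 6 : ℂ) * (spinDot 2 (0 : Fin 2) 1 *ᵥ (spinDot 2 (0 : Fin 2) 1 *ᵥ v)) σ +
        (1 / 2 : ℂ) * (spinDot 2 (0 : Fin 2) 1 *ᵥ v) σ + (1 / 3 : ℂ) * v σ := by
  simp only [add_mulVec, smul_mulVec, ← mulVec_mulVec, one_mulVec, Pi.add_apply,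
    Pi.smul_apply, smul_eq_mul]

/-! ### Two-site amplitudes of the AKLT tensor -/

/-- The AKLT tensor in terms of two complex parameters `s, t` with `s² = 2/3`, `t² = 1/3`
(`s = √(2/3)`, `t = √(1/3)`): `A⁺ = s σ⁺`, `A⁰ = -t σᶻ`, `A⁻ = -s σ⁻`. Only these algebraic
relations are used below. Schollwöck (2011) §4.1.5, eq. (79). [folklore] -/
theorem akltTensor_eq_of_sq :
    ∃ s t : ℂ, s ^ 2 = 2 / 3 ∧ t ^ 2 = 1 / 3 ∧
      akltTensor = ![!![0, s; 0, 0], !![-t, 0; 0, t], !![0, 0; -s, 0]] := by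
  refine ⟨(Real.sqrt (2 / 3) : ℝ), (Real.sqrt (1 / 3) : ℝ), ?_, ?_, ?_⟩
  · rw [← Complex.ofReal_pow, Real.sq_sqrt (by norm_num)]
    push_cast; ring
  · rw [← Complex.ofReal_pow, Real.sq_sqrt (by norm_num)]
    push_cast; ring
  · ext k i j
    fin_cases k <;> fin_cases i <;> fin_cases j <;> simp [akltTensor]

/-- **Two-site amplitudes `ψ_B(k₀,k₁) = tr (B A^{k₀} A^{k₁})` of the AKLT tensor** (with
`A⁺ = s σ⁺`, `A⁰ = -t σᶻ`, `A⁻ = -s σ⁻`): the `m = ±1` components `ψ_B(+,0) = -ψ_B(0,+) = st B₁₀`,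
`ψ_B(-,0) = -ψ_B(0,-) = st B₀₁` are antisymmetric (bond spin `1`), `ψ_B(±,±) = 0`, and
`ψ_B(+,-) = -s² B₀₀`, `ψ_B(0,0) = t² tr B`, `ψ_B(-,+) = -s² B₁₁`.
Fannes–Nachtergaele–Werner (1992), Example 1 (p. 451) and §7 (p. 485); AKLT (1988) §2.
[folklore] -/
theorem mpsWithBoundary_two_aklt_apply (s t : ℂ) (B : Matrix (Fin 2) (Fin 2) ℂ) (c e : Fin 3) :
    mpsWithBoundary 2
        (![!![0, s; 0, 0], !![-t, 0; 0, t], !![0, 0; -s, 0]] : MPSTensor 3 2)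
        B ![c, e] =
      ![![0, s * t * B 1 0, -(s * s * B 0 0)],
        ![-(s * t * B 1 0), t * t * (B 0 0 + B 1 1), -(s * t * B 0 1)],
        ![-(s * s * B 1 1), s * t * B 0 1, 0]] c e := by
  simp only [mpsWithBoundary, wordProduct_fin_two, Matrix.cons_val_zero, Matrix.cons_val_one]
  fin_cases c <;> fin_cases e <;>
    simp only [Fin.reduceFinMk, Fin.zero_eta, Fin.mk_one, Fin.isValue, Matrix.cons_val] <;>
    simp [Matrix.trace_fin_two, Matrix.mul_apply, Fin.sum_univ_two] <;> ring

/-- **`P₂` annihilates the AKLT amplitudes**: `(⅙ (𝐒₀·𝐒₁)² + ½ 𝐒₀·𝐒₁ + ⅓) ψ_B = 0` for every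
boundary matrix `B`, i.e. `𝒢₂ ⊆ ker P₂` (the two-site AKLT states carry bond spin `≤ 1`); uses
`s² = 2 t²`. Fannes–Nachtergaele–Werner (1992) §7, p. 485 (`V⁽²⁾𝒦 ⊆ 𝒮_{≤ s}`); AKLT (1988)
§2. [folklore] -/
theorem akltProj_mulVec_mpsWithBoundary (s t : ℂ) (hs : s ^ 2 = 2 / 3) (ht : t ^ 2 = 1 / 3)
    (B : Matrix (Fin 2) (Fin 2) ℂ) :
    ((1 / 6 : ℂ) • (spinDot 2 (0 : Fin 2) 1 * spinDot 2 (0 : Fin 2) 1) +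
        (1 / 2 : ℂ) • spinDot 2 (0 : Fin 2) 1 + (1 / 3 : ℂ) • (1 : Op (Fin 2) 3)) *ᵥ
      mpsWithBoundary 2
        (![!![0, s; 0, 0], !![-t, 0; 0, t], !![0, 0; -s, 0]] : MPSTensor 3 2) B
      = 0 := by
  funext σ
  obtain ⟨a, b, rfl⟩ : ∃ a b : Fin 3, σ = (![a, b] : Fin 2 → Fin 3) :=
    ⟨σ 0, σ 1, eq_vecCons_fin_two σ⟩
  rw [akltProj_mulVec_apply, Pi.zero_apply]
  fin_cases a <;> fin_cases b <;>
    simp only [Fin.reduceFinMk, Fin.zero_eta, Fin.mk_one, Fin.isValue] <;>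
    simp only [spinDot_two_mulVec_apply, mpsWithBoundary_two_aklt_apply, Matrix.cons_val] <;>
    ring_nf <;> (try simp only [hs, ht]) <;> ring_nf

/-- **`1 - P₂` maps into the AKLT amplitudes**: for every two-site vector `u` the vector
`u - P₂ u` is an AKLT amplitude `ψ_B` for the explicit boundary matrix
`B = [[-(5u₊₋ - 2u₀₀ - u₋₊)/4, (9/4) s t (u₋₀ - u₀₋)],`
`[(9/4) s t (u₊₀ - u₀₊), -(5u₋₊ - u₊₋ - 2u₀₀)/4]]`,
i.e. `ran (1 - P₂) ⊆ 𝒢₂` (the bond-spin `0 ⊕ 1` sector is exhausted by the AKLT states);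
uses `s² = 2/3`, `t² = 1/3`. Fannes–Nachtergaele–Werner (1992) §7, p. 485–486; AKLT (1988) §2.
[folklore] -/
theorem mpsWithBoundary_two_aklt_eq_sub_akltProj_mulVec (s t : ℂ) (hs : s ^ 2 = 2 / 3)
    (ht : t ^ 2 = 1 / 3) (u : (Fin 2 → Fin 3) → ℂ) :
    mpsWithBoundary 2
        (![!![0, s; 0, 0], !![-t, 0; 0, t], !![0, 0; -s, 0]] : MPSTensor 3 2)
        !![-(5 * u ![0, 2] - 2 * u ![1, 1] - u ![2, 0]) / 4,
            (9 / 4 : ℂ) * s * t * (u ![2, 1] - u ![1, 2]);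
          (9 / 4 : ℂ) * s * t * (u ![0, 1] - u ![1, 0]),
            -(5 * u ![2, 0] - u ![0, 2] - 2 * u ![1, 1]) / 4] =
      u - ((1 / 6 : ℂ) • (spinDot 2 (0 : Fin 2) 1 * spinDot 2 (0 : Fin 2) 1) +
        (1 / 2 : ℂ) • spinDot 2 (0 : Fin 2) 1 + (1 / 3 : ℂ) • (1 : Op (Fin 2) 3)) *ᵥ u := by
  funext σ
  obtain ⟨a, b, rfl⟩ : ∃ a b : Fin 3, σ = (![a, b] : Fin 2 → Fin 3) :=
    ⟨σ 0, σ 1, eq_vecCons_fin_two σ⟩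
  rw [Pi.sub_apply, akltProj_mulVec_apply]
  fin_cases a <;> fin_cases b <;>
    simp only [Fin.reduceFinMk, Fin.zero_eta, Fin.mk_one, Fin.isValue] <;>
    simp only [spinDot_two_mulVec_apply, mpsWithBoundary_two_aklt_apply, Matrix.cons_val,
      Matrix.of_apply, Matrix.cons_val'] <;>
    ring_nf <;> (try simp only [hs, ht]) <;> ring_nf

/-! ### Characterisation of an orthogonal projection matrix -/

/-- A matrix `P` with `P v ∈ Kᗮ` and `v - P v ∈ K` for all `v` is the matrix of the orthogonal
projection onto `Kᗮ` (uniqueness of the orthogonal decomposition `v = (v - Pv) + Pv`).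
[folklore] -/
theorem projMatrix_orthogonal_eq_of {n : Type*} [Fintype n] [DecidableEq n]
    (K : Submodule ℂ (EuclideanSpace ℂ n)) (P : Matrix n n ℂ)
    (h1 : ∀ v : EuclideanSpace ℂ n, WithLp.toLp 2 (P *ᵥ WithLp.ofLp v) ∈ Kᗮ)
    (h2 : ∀ v : EuclideanSpace ℂ n, v - WithLp.toLp 2 (P *ᵥ WithLp.ofLp v) ∈ K) :
    projMatrix Kᗮ = P := by
  have h : Kᗮ.starProjection = Matrix.toEuclideanCLM (n := n) (𝕜 := ℂ) P := by
    ext1 v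
    have hv : Matrix.toEuclideanCLM (n := n) (𝕜 := ℂ) P v =
        WithLp.toLp 2 (P *ᵥ WithLp.ofLp v) := by
      rw [← Matrix.toEuclideanCLM_toLp, WithLp.toLp_ofLp]
    rw [hv]
    exact Submodule.eq_starProjection_of_mem_orthogonal (h1 v)
      (by rw [Submodule.orthogonal_orthogonal]; exact h2 v)
  rw [projMatrix, h, StarAlgEquiv.symm_apply_apply]

/-! ### The local identity: `h = 1 - P_{𝒢₂} = P₂` for the AKLT tensor -/

/-- **The two-site parent term of the AKLT tensor is the bond-spin-`2` projection.** With block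
length `ℓ = 2` the MPS space `𝒢₂ = {ψ_B}` of the AKLT tensor is the bond-spin `0 ⊕ 1` sector of
two spins `1`, so the local parent term `h = 1 - P_{𝒢₂}` (`parentLocalTerm`, the orthogonal
projection onto `𝒢₂ᗮ`) is the projection onto bond spin `2`,
`P₂ = ⅙ (𝐒₀ · 𝐒₁)² + ½ 𝐒₀ · 𝐒₁ + ⅓`. Proof: `P₂` is Hermitian, kills every `ψ_B`
(`akltProj_mulVec_mpsWithBoundary`), and `v - P₂ v` is an AKLT amplitude for every `v`
(`mpsWithBoundary_two_aklt_eq_sub_akltProj_mulVec`); these two inclusions characterise the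
orthogonal projection onto `𝒢₂ᗮ` (`projMatrix_orthogonal_eq_of`).
Fannes–Nachtergaele–Werner (1992), eq. (1.1) (p. 445: "the expression in braces is nothing but
the projection onto the spin 2 subspace") and §7, pp. 485–486 (for `J = 1`, `j = 1/2` the
nearest-neighbour interaction `h` is precisely the AKLT model); AKLT, CMP 115 (1988), eq. (1.2)
and §2. [cite: FannesNachtergaeleWernerCMP1992, eq. (1.1) p. 445 and §7 pp. 485–486] -/
theorem parentLocalTerm_two_akltTensor :
    parentLocalTerm 2 akltTensor =
      (1 / 6 : ℂ) • (spinDot 2 (0 : Fin 2) 1 * spinDot 2 (0 : Fin 2) 1) +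
        (1 / 2 : ℂ) • spinDot 2 (0 : Fin 2) 1 + (1 / 3 : ℂ) • (1 : Op (Fin 2) 3) := by
  obtain ⟨s, t, hs, ht, hA⟩ := akltTensor_eq_of_sq
  have hC1 : ∀ B : Matrix (Fin 2) (Fin 2) ℂ,
      ((1 / 6 : ℂ) • (spinDot 2 (0 : Fin 2) 1 * spinDot 2 (0 : Fin 2) 1) +
        (1 / 2 : ℂ) • spinDot 2 (0 : Fin 2) 1 + (1 / 3 : ℂ) • (1 : Op (Fin 2) 3)) *ᵥ
          mpsWithBoundary 2 akltTensor B = 0 := fun B => by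
    rw [hA]
    exact akltProj_mulVec_mpsWithBoundary s t hs ht B
  have hC2 : ∀ u : (Fin 2 → Fin 3) → ℂ, ∃ B : Matrix (Fin 2) (Fin 2) ℂ,
      mpsWithBoundary 2 akltTensor B =
        u - ((1 / 6 : ℂ) • (spinDot 2 (0 : Fin 2) 1 * spinDot 2 (0 : Fin 2) 1) +
          (1 / 2 : ℂ) • spinDot 2 (0 : Fin 2) 1 + (1 / 3 : ℂ) • (1 : Op (Fin 2) 3)) *ᵥ u :=
      fun u => by
    rw [hA]
    exact ⟨_, mpsWithBoundary_two_aklt_eq_sub_akltProj_mulVec s t hs ht u⟩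
  have hD : (spinDot 2 (0 : Fin 2) 1)ᴴ = spinDot 2 (0 : Fin 2) 1 := (spinDot_isHermitian 2 _ _).eq
  have hP : ((1 / 6 : ℂ) • (spinDot 2 (0 : Fin 2) 1 * spinDot 2 (0 : Fin 2) 1) +
        (1 / 2 : ℂ) • spinDot 2 (0 : Fin 2) 1 + (1 / 3 : ℂ) • (1 : Op (Fin 2) 3))ᴴ =
      (1 / 6 : ℂ) • (spinDot 2 (0 : Fin 2) 1 * spinDot 2 (0 : Fin 2) 1) +
        (1 / 2 : ℂ) • spinDot 2 (0 : Fin 2) 1 + (1 / 3 : ℂ) • (1 : Op (Fin 2) 3) := by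
    simp only [conjTranspose_add, conjTranspose_smul, conjTranspose_mul, conjTranspose_one, hD,
      Complex.star_def, map_div₀, map_one, map_ofNat]
  generalize ((1 / 6 : ℂ) • (spinDot 2 (0 : Fin 2) 1 * spinDot 2 (0 : Fin 2) 1) +
      (1 / 2 : ℂ) • spinDot 2 (0 : Fin 2) 1 + (1 / 3 : ℂ) • (1 : Op (Fin 2) 3)) = P at hC1 hC2 hP ⊢
  unfold parentLocalTerm
  refine projMatrix_orthogonal_eq_of _ P (fun v => ?_) (fun v => ?_)
  · rw [Submodule.mem_orthogonal]
    intro u hu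
    unfold mpsRange at hu
    induction hu using Submodule.span_induction with
    | mem u hu =>
      obtain ⟨B, rfl⟩ := hu
      have h0 : star (mpsWithBoundary 2 akltTensor B) ᵥ* P = 0 := by
        rw [← hP, ← star_mulVec, hC1 B, star_zero]
      rw [EuclideanSpace.inner_toLp_toLp, dotProduct_comm, dotProduct_mulVec, h0, zero_dotProduct]
    | zero => exact inner_zero_left _
    | add x y _ _ hx hy => rw [inner_add_left, hx, hy, add_zero]
    | smul c x _ hx => rw [inner_smul_left, hx, mul_zero]
  · obtain ⟨B, hB⟩ := hC2 (WithLp.ofLp v)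
    unfold mpsRange
    refine Submodule.subset_span ⟨B, ?_⟩
    change WithLp.toLp 2 (mpsWithBoundary 2 akltTensor B) = _
    rw [hB, WithLp.toLp_sub, WithLp.toLp_ofLp]

/-! ### Blocks of the ring `ℤ/L` -/

/-- **The transported exchange operator.** Placing the two-site exchange operator `𝐒₀ · 𝐒₁` on the
block `{x, x+1}` of the ring `ℤ/L` (`2 ≤ L`) gives `𝐒_x · 𝐒_{x+1}`. Tasaki (2020) §2.4;
Bratteli–Robinson II §6.2.1. [folklore] -/
theorem localOp_onRingBlock_spinDot (L : ℕ) [NeZero L] (hL : 2 ≤ L) (x : ZMod L) :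
    localOp (ringBlock L 2 x) (onRingBlock L 2 x (spinDot 2 (0 : Fin 2) 1)) =
      spinDot 2 x (x + 1) := by
  have hg := ringBlockSite_bijective L 2 hL x
  have h0 : ((ringBlockSite L 2 x 0 : ringBlock L 2 x) : ZMod L) = x := by
    simp [ringBlockSite]
  have h1 : ((ringBlockSite L 2 x 1 : ringBlock L 2 x) : ZMod L) = x + 1 := by
    simp [ringBlockSite]
  simp only [onRingBlock, spinDot, spinBond, siteSpin, localOp_submatrix_sum,
    localOp_submatrix_smul, localOp_submatrix_add, localOp_submatrix_mul _ hg,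
    localOp_submatrix_onSite _ hg, h0, h1]

/-! ### Discharge of `parentHamiltonian_akltTensor_eq` -/

/-- **Discharge of `parentHamiltonian_akltTensor_eq`: the AKLT Hamiltonian is the parent
Hamiltonian of the AKLT tensor.** On the ring `ℤ/L`, `2 ≤ L`, the parent Hamiltonian with block
length `2` is `Σ_i P₂(i, i+1) = Σ_i (⅙ (𝐒_i · 𝐒_{i+1})² + ½ 𝐒_i · 𝐒_{i+1} + ⅓)`: each block term
`h = 1 - P_{𝒢₂}` is the bond-spin-`2` projection (`parentLocalTerm_two_akltTensor`), and placing
it on the block `{i, i+1}` turns `𝐒₀ · 𝐒₁` into `𝐒_i · 𝐒_{i+1}` (`localOp_onRingBlock_spinDot`,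
the placement being a unital algebra homomorphism, `LocalOpTransport`).
Fannes–Nachtergaele–Werner (1992), eq. (1.1), p. 445, and §7, pp. 485–486; AKLT, CMP 115
(1988), eq. (1.2). [cite: FannesNachtergaeleWernerCMP1992, eq. (1.1) p. 445 and §7 pp. 485–486] -/
theorem parentHamiltonian_akltTensor_eq_holds : parentHamiltonian_akltTensor_eq := by
  intro L _ hL
  unfold parentHamiltonian
  refine Finset.sum_congr rfl fun x _ => ?_
  have hg := ringBlockSite_bijective L 2 hL x
  have hD := localOp_onRingBlock_spinDot L hL x
  rw [parentLocalTerm_two_akltTensor]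
  simp only [onRingBlock] at hD ⊢
  simp only [localOp_submatrix_add, localOp_submatrix_smul, localOp_submatrix_mul _ hg,
    localOp_submatrix_one _ hg, hD]

end QLattice

end Literature.MathematicalPhysics.QuantumLattice
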